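import Literature.MathematicalPhysics.QuantumFieldTheory.Balaban1983to89.B9RWSums343Holder

/-!
# `Balaban1983to89.B9RWSums343HolderGp` — [B9] the Hölder member (3.43) of the random walk sum (3.90) G′(U) PROVED inside the
# leaf of Theorem 3.7 at the all-blocks pin: the G′ twin of `B9RWSums343Holder` at n06-c's letters `B9Thm37Whole.Ops`

T. Bałaban, *Propagators for lattice gauge theories in a background field*, Commun. Math. Phys. **99** (1985) 389–434
[`Balaban1985BackgroundPropagators`, "B9"]; [4] = T. Bałaban, *Propagators and renormalization transformations for lattice
gauge theories. II*, Commun. Math. Phys. **96** (1984) 223–250 [`Balaban1984PropagatorsII`].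

statement-level skeleton of published theorems with citation tags; proofs where landed; nothing here is a claim about the
Yang–Mills mass gap

THE PRINTED LOCI (verbatim).  Theorem 3.7, p. 409: *"the operator G′ can be represented as G′ = G′₀(I − R′)⁻¹ = G′₀Σ_{n=0}^∞ R′ⁿ
= Σ_ω h_{□₀}G′_{□₀}h_{□₀}K(h_{□₁})G′_{□₁}h_{□₁}…K(h_{□ₙ})G′_{□ₙ}h_{□ₙ}, (3.90) … The expansion is convergent in all norms appearing
in the inequalities (3.42)–(3.47)."*; p. 410: *"This theorem follows simply from Corollary 3.6 holding for all G′_□, □ ∈ 𝒟,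
from the bound (3.89) and Lemma 2.1. … Theorem 3.7 implies that all the inequalities (3.42)–(3.47) hold for G′"*; (3.88)
p. 409: *"Δ′_aG′₀ = I − Σ_□K(h_□)G′_□h_□ = I − R′"*; (3.89): *"|(K(h_□)G′_□h_□λ)(x)| ≦ O(M⁻¹)e^{−δ₀(L^jη)⁻¹|y−y′|}|λ|"*; (3.43)
p. 398: *"‖ζ∇_UG′(U)λ‖_β, ‖ζG′(U)∇\*_Uλ‖_β ≦ B₀(β₀)(L^jη)^{1−β}(‖ζ‖^ξ_β + |ζ|)e^{−δ₀d(y,y′)}|λ|"*; Corollary 3.8 p. 410: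
*"Similar estimates hold for the other norms."*

THE POINT.  `B9RWSums343Holder` proves the member (3.43) of the sum G(U) of (3.107) inside the leaf of Theorem 3.10 (probe
lattices: each transported Hölder quotient (3.40) with a cut-off is one linear functional of the output).  THIS FILE is the
twin for the sum (3.90) G′(U) at n06-c's letters `B9Thm37Whole.Ops` and the all-blocks pin `B9RWSums343to347Whole.E37AllOfOps`:

* §1 schemas `HolderLegs37` (Corollary 3.6's (3.43) for the head terms h_□G′_□h_□ through Φ^Y_β∘∇_U and through Φ^X_β(·)∘∇\*_U,
  localized — POSITED incl. the product rule through h_□, as `B9Thm37AllNorms.thm37_left`'s `hleg`), `HolderV37` (the terms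
  h_□G′_□K(h_□)ᵗ of the transposed (3.88) read through Φ^X_β, scale-weighted as `B9Thm37Glue.rightR_cube_majorant` — POSITED);
  `holder343_of_local37` — ONE member, ONE U: both probe majorants of G′(U) (left: G′ = G′₀ + G′R′ from (3.88), R′ majorised by
  (3.89) from Cor. 3.6 entries 1, 2 via `B9Thm37Glue.h389_of_342`, and `B9RWSums343Holder.leftMember_of_localLegs`; right: the
  transposed (3.88) G′∇\* = G′₀∇\* + V(G′∇\*) (`B9Thm37Glue.fixedPoint_of_388T`), the entry-3 sup majorant of `Conv342` and
  `rightMember_of_localLegs`).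
* §2 ★ `thm37Printed_allPin_schur_holder` — the leaf `B9.Thm37Printed` at `E37AllOfOps …` with (3.42) + (3.47) + (3.46)₁,₂,₃ +
  (3.43) PROVED inside; displayed: (3.44), (3.45), (3.46)₄,₅,₆ only.

HONEST SCOPE.  Nothing of print is asserted: the probe letters, the co-reading `H1Reads`, the Hölder legs and the probe bounds
of the V-terms are hypotheses of printed shape (Cor. 3.6 (3.43) for the G′_□ and the product rule of (3.40) through h_□ with the
sizes (3.100) of ∂h_□ — not displayed in print, cell GAPS G-pv21g4-1 (i)); the input-side Hölder members (3.44), (3.45) (GAPS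
G-B9-02∕07) and (3.46)₄,₅,₆ stay displayed.  Kernel-checked bookkeeping shrinking a located residual; NOT a node discharge, NOT
summit progress; one finite lattice paper; nothing continuum, nothing about the mass gap.  Cell `pub-ymgap` (HUMAN RULING
D-0062), Track A node N06 [B9], seat `pub-ymgap-dag-n06-k` (rows 18–19, successor gen), 2026-08-26.
-/

namespace Literature.MathematicalPhysics.QuantumFieldTheory.Balaban1983to89.B9RWSums343HolderGp

open Literature.MathematicalPhysics.QuantumFieldTheory.Balaban1983to89
open Finset B6RandomWalk B6RandomWalkHom B9Thm37Sum B9Thm34Ext B9Thm37Glue B9Thm37Whole B9Cor38Whole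
open B9RWSums343to347Whole B9RWSums346Schur B9Thm37GlueCor36 B9RWSums343Holder

noncomputable section

/-! ## §1 The sum G′(U) of (3.90) at one member and one U -/

section GpSide

variable {g : B9.Geometry} [Fintype g.Site] [DecidableEq g.Site] {R : ℝ} {H : Prop} {B : B9.Backgrounds}
variable {X Y ι PX PY : Type}

/-- **COROLLARY 3.6's (3.43) FOR THE HEAD TERMS h_□G′_□(U)h_□ OF (3.90), READ THROUGH THE PROBES, LOCALIZED** (p. 409–410:
*"G′_□(U) … satisfy all the inequalities of Theorems 3.1–3.3"*, *"Corollary 3.6 holding for all G′_□"*; (3.43) p. 398): for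
0 ≦ β < 1 and every □, Φ^Y_β(U)∘∇_U∘(h_□G′_□h_□) and Φ^X_β(U)∘(h_□G′_□h_□)∘∇\*_U have the two-space sup majorants
1_{S_H(□)}(y)·B_ℓ(β)(L^jη)^{1−β}e^{−δ₀d(y,y′)}.  POSITED AS A WHOLE ((3.43) for G′_□ + the product rule of (3.40) through h_□ +
the sizes (3.100) of ∂h_□, the latter two not displayed in print); the `hleg` of `B9Thm37AllNorms.thm37_left` at a probe lattice.
A HYPOTHESIS SCHEMA; Corollary 3.6 is not asserted. [cite: Balaban1985BackgroundPropagators, Cor. 3.6 p.408 + (3.87) p.409 + (3.43) p.398 + (3.100) p.413] -/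
structure HolderLegs37 (𝔬 : Ops g B X Y ι) (𝔭 : HolderProbes g B X Y PX PY) (R : ℝ) (H : Prop)
    (SH : ι → Finset g.Site) (Bl : ℝ → ℝ) (δ₀ : ℝ) (U : B.Cfg) : Prop where
  left : ∀ β : ℝ, 0 ≤ β → β < 1 → ∀ i, HasMajorantHom (g := toB6 g R H) 𝔬.blk 𝔭.blkPY
    ((𝔭.ΦY U β ∘ₗ 𝔬.D U) ∘ₗ (mulOp (𝔬.h i) * 𝔬.Gsq U i * mulOp (𝔬.h i)))
    (fun (a b : g.Site) => (if a ∈ SH i then (1 : ℝ) else 0) *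
      (Bl β * g.len a ^ (1 - β) * Real.exp (-(δ₀ * g.dist a b))))
  right : ∀ β : ℝ, 0 ≤ β → β < 1 → ∀ i, HasMajorantHom (g := toB6 g R H) 𝔬.blkY 𝔭.blkPX
    (𝔭.ΦX U β ∘ₗ ((mulOp (𝔬.h i) * 𝔬.Gsq U i * mulOp (𝔬.h i)) ∘ₗ 𝔬.Dstar U))
    (fun (a b : g.Site) => (if a ∈ SH i then (1 : ℝ) else 0) *
      (Bl β * g.len a ^ (1 - β) * Real.exp (-(δ₀ * g.dist a b))))

/-- **THE TERMS h_□G′_□K(h_□)ᵗ OF THE TRANSPOSED (3.88) READ THROUGH THE PROBES Φ^X_β(U)** (G′₀Δ′_a = I − V, V = Σ_□h_□G′_□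
(∇\*_UPᵗ_□ + Cᵗ_□), `B9Thm37Whole.Identities.eq388T`): for 0 ≦ β < 1 and every □, Φ^X_β∘(h_□G′_□(∇\*_UPᵗ_□ + Cᵗ_□)) has the
scale-weighted majorant 1_{S′_□}(y′)·B_V(β)·(L^jη)^{1−β}(L^{j′}η)⁻¹·e^{−δ₀d(y,y′)} — the Hölder-probe companion of the sup shape of
`B9Thm37Glue.rightR_cube_majorant` (there: B₀e^{δ₀ρ}(κ₁ + C_ℓκ₂)·L^jη(L^{j′}η)⁻¹, from entries 1, 3 of Cor. 3.6 and the column sums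
(3.100) of the coefficient kernels).  POSITED (in print: (3.43) for G′_□ read against the local coefficient operators).
A HYPOTHESIS SCHEMA. [cite: Balaban1985BackgroundPropagators, (3.88)–(3.89) p.409 + (3.43) p.398 + (3.100) p.413; Balaban1984PropagatorsII, (2.40)–(2.44) p.230] -/
structure HolderV37 (𝔬 : Ops g B X Y ι) (𝔭 : HolderProbes g B X Y PX PY) (R : ℝ) (H : Prop) (BV : ℝ → ℝ) (δ₀ : ℝ)
    (U : B.Cfg) : Prop where
  probeV : ∀ β : ℝ, 0 ≤ β → β < 1 → ∀ i, HasMajorantHom (g := toB6 g R H) 𝔬.blk 𝔭.blkPX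
    (𝔭.ΦX U β ∘ₗ (mulOp (𝔬.h i) * 𝔬.Gsq U i * (𝔬.Dstar U ∘ₗ 𝔬.Pt U i + 𝔬.Ct U i)))
    (fun (y y' : g.Site) => (if y' ∈ 𝔬.S' i then (1 : ℝ) else 0) * BV β *
      (g.len y ^ (1 - β) * (g.len y')⁻¹) * Real.exp (-(δ₀ * g.dist y y')))

/-- **THE MEMBER (3.43) OF THE SUM G′(U) OF (3.90) AT ONE MEMBER AND ONE CONFIGURATION U — both probe majorants.**  LEFT:
Φ^Y_β∘∇_U∘G′ = Φ^Y_β∘∇_U∘G′₀ + (Φ^Y_β∘∇_U∘G′)∘R′ from G′ = G′₀ + G′R′ ((3.88) + G′Δ′_a = I, `B9Thm37Sum.fixedPoint_of_388`), R′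
majorised cube by cube by (3.89) from Cor. 3.6 entries 1, 2 (`B9Thm37Glue.h389_of_342`) and summed with N′, the Hölder legs
summed with N_H, and `leftMember_of_localLegs` under the located smallness N′B₀e^{δ₀ρ}(κ_P + κ_C)c₁(α) ≦ ½ of
`B9Thm37Whole.conv342_of_local342`; RIGHT: the transposed (3.88) G′∇\* = G′₀∇\* + V(G′∇\*) (`B9Thm37Glue.fixedPoint_of_388T`,
Δ′_aG′ = I by `mul_eq_one_comm` on the finite lattice), the right legs, the probe bounds of the V-terms summed with N′, the
entry-3 sup majorant C·L^jη·e^{−δd} of G′ (`Conv342`, third conjunct) and `rightMember_of_localLegs`.  For 0 ≦ δ ≦ (1 − α)δ₀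
both members have the majorant `holderConst d δ₀ α N_H N′ C B_ℓ(β) B_V(β)`·(L^jη)^{1−β}e^{−δd(y,y′)}.
[cite: Balaban1985BackgroundPropagators, Thm 3.7 (3.87)–(3.90) pp.408–410 + (3.43) p.398; Balaban1984PropagatorsII, Prop 2.2 (2.64)–(2.66) p.234] -/
theorem holder343_of_local37 [Fintype X] [DecidableEq X] [Fintype Y] [DecidableEq Y] [Fintype ι] [Fintype PX]
    [DecidableEq PX] [Fintype PY] [DecidableEq PY]
    (𝔬 : Ops g B X Y ι) (𝔭 : HolderProbes g B X Y PX PY) (R : ℝ) (H : Prop) (d : ℕ)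
    (δ₀ α ρ B₀ N N' Cℓ NH C δ : ℝ) (κ : Sizes) (SH : ι → Finset g.Site) (Bl BV : ℝ → ℝ) (U : B.Cfg)
    (hB₀ : 0 ≤ B₀) (hδ₀ : 0 ≤ δ₀) (hα : 0 ≤ α) (hα1 : α ≤ 1) (hN' : 0 ≤ N') (hNH : 0 ≤ NH) (hC : 0 ≤ C) (hδ : 0 ≤ δ)
    (hδle : δ ≤ (1 - α) * δ₀)
    (hs : StaticOK 𝔬 ρ N N' Cℓ κ) (hκ : κ.Nonneg) (hcntH : ∀ a : g.Site, (∑ i, if a ∈ SH i then (1 : ℝ) else 0) ≤ NH)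
    (hBl : ∀ β, 0 ≤ β → β < 1 → 0 ≤ Bl β) (hBV : ∀ β, 0 ≤ β → β < 1 → 0 ≤ BV β)
    (h261 : Ineq261 d (toB6 g R H) δ₀ α)
    (hq : N' * (B₀ * Real.exp (δ₀ * ρ) * (κ.kP + κ.kC)) * B6.c1 d δ₀ α ≤ 1 / 2)
    (hl : Local342 𝔬 R H B₀ δ₀ U) (hi : Identities 𝔬 R H U)
    (hL : HolderLegs37 𝔬 𝔭 R H SH Bl δ₀ U) (hV : HolderV37 𝔬 𝔭 R H BV δ₀ U)
    (h2 : HasMajorantHom (g := toB6 g R H) 𝔬.blkY 𝔬.blk (𝔬.Gp U ∘ₗ 𝔬.Dstar U)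
      (fun (a b : g.Site) => C * g.len a * Real.exp (-(δ * g.dist a b)))) :
    ∀ β : ℝ, 0 ≤ β → β < 1 →
      HasMajorantHom (g := toB6 g R H) 𝔬.blk 𝔭.blkPY ((𝔭.ΦY U β ∘ₗ 𝔬.D U) ∘ₗ 𝔬.Gp U)
          (fun (a b : g.Site) => holderConst d δ₀ α NH N' C (Bl β) (BV β) * g.len a ^ (1 - β) *
            Real.exp (-(δ * g.dist a b))) ∧
        HasMajorantHom (g := toB6 g R H) 𝔬.blkY 𝔭.blkPX (𝔭.ΦX U β ∘ₗ (𝔬.Gp U ∘ₗ 𝔬.Dstar U))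
          (fun (a b : g.Site) => holderConst d δ₀ α NH N' C (Bl β) (BV β) * g.len a ^ (1 - β) *
            Real.exp (-(δ * g.dist a b))) := by
  intro β hβ0 hβ1
  have hlen : ∀ y : g.Site, 0 ≤ g.len y := fun y => (hs.lenpos y).le
  have hW : ∀ y : g.Site, 0 ≤ g.len y ^ (1 - β) := fun y => Real.rpow_nonneg (hlen y) _
  have htri : Triangle254 (toB6 g R H) := fun a b c => hs.tri a b c
  have hc1 : 0 ≤ B6.c1 d δ₀ α := c1_nonneg d δ₀ α
  have hk12 : 0 ≤ κ.kP + κ.kC := add_nonneg hκ.kP hκ.kC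
  have hθ : 0 ≤ N' * (B₀ * Real.exp (δ₀ * ρ) * (κ.kP + κ.kC)) :=
    mul_nonneg hN' (mul_nonneg (mul_nonneg hB₀ (Real.exp_nonneg _)) hk12)
  have hsmall : N' * (B₀ * Real.exp (δ₀ * ρ) * (κ.kP + κ.kC)) * B6.c1 d δ₀ α < 1 := by linarith
  have hb : 0 ≤ Bl β := hBl β hβ0 hβ1
  have hv : 0 ≤ BV β := hBV β hβ0 hβ1
  have hαδ₀ : 0 ≤ α * δ₀ := mul_nonneg hα hδ₀
  have hexp : ∀ a b : g.Site, Real.exp (-((1 - α) * δ₀ * g.dist a b)) ≤ Real.exp (-(δ * g.dist a b)) := fun a b =>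
    Real.exp_le_exp.mpr (neg_le_neg (mul_le_mul_of_nonneg_right hδle (hs.dnn a b)))
  -- (3.89) cube by cube, summed with N′: R′ has majorant N′B₀e^{δ₀ρ}(κ_P + κ_C)e^{−δ₀d}
  have h389 := h389_of_342 (R := R) (H := H) 𝔬.blk 𝔬.blkY δ₀ ρ B₀ κ.kP κ.kC 𝔬.S' 𝔬.h 𝔬.KP 𝔬.KC hB₀ hδ₀ htri hlen hs.hh
    hs.KP_nonneg hs.KP_loc hs.KP_row hs.KC_nonneg hs.KC_loc hs.KC_row hl.e0 hl.e1 hi.hP hi.hC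
  have hRa : ∀ i, HasMajorant (g := toB6 g R H) 𝔬.blk ((𝔬.P U i ∘ₗ 𝔬.D U + 𝔬.Cop U i) * 𝔬.Gsq U i * mulOp (𝔬.h i))
      (fun (a b : g.Site) => (if a ∈ 𝔬.S' i then (1 : ℝ) else 0) *
        (B₀ * Real.exp (δ₀ * ρ) * (κ.kP + κ.kC) * Real.exp (-(δ₀ * g.dist a b)))) :=
    fun i => hasMajorant_mono (g := toB6 g R H) 𝔬.blk (h389 i) fun a b => le_of_eq (by split_ifs <;> simp)
  have hR : HasMajorant (g := toB6 g R H) 𝔬.blk (∑ i, (𝔬.P U i ∘ₗ 𝔬.D U + 𝔬.Cop U i) * 𝔬.Gsq U i * mulOp (𝔬.h i))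
      (fun (a b : g.Site) => N' * (B₀ * Real.exp (δ₀ * ρ) * (κ.kP + κ.kC)) * Real.exp (-(δ₀ * g.dist a b))) := by
    have hloc := hasMajorant_localSum (G := toB6 g R H) 𝔬.blk
      (fun i => (𝔬.P U i ∘ₗ 𝔬.D U + 𝔬.Cop U i) * 𝔬.Gsq U i * mulOp (𝔬.h i))
      (fun i (a : g.Site) => if a ∈ 𝔬.S' i then (1 : ℝ) else 0)
      (fun (a b : g.Site) => B₀ * Real.exp (δ₀ * ρ) * (κ.kP + κ.kC) * Real.exp (-(δ₀ * g.dist a b))) N'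
      (fun a b => mul_nonneg (mul_nonneg (mul_nonneg hB₀ (Real.exp_nonneg _)) hk12) (Real.exp_nonneg _)) hRa hs.cnt'
    exact hasMajorant_mono (g := toB6 g R H) 𝔬.blk hloc fun a b => le_of_eq (by ring)
  -- G′ = G′₀ + G′R′ ((3.88) and G′Δ′_a = I)
  have hfix : 𝔬.Gp U = (∑ i, mulOp (𝔬.h i) * 𝔬.Gsq U i * mulOp (𝔬.h i)) +
      𝔬.Gp U * ∑ i, (𝔬.P U i ∘ₗ 𝔬.D U + 𝔬.Cop U i) * 𝔬.Gsq U i * mulOp (𝔬.h i) :=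
    fixedPoint_of_388 hi.inv hi.eq388
  have eL := leftMember_of_localLegs (R := R) (H := H) 𝔬.blk 𝔭.blkPY d δ₀ α (N' * (B₀ * Real.exp (δ₀ * ρ) * (κ.kP + κ.kC)))
    (Bl β) NH (fun y => g.len y ^ (1 - β)) (fun i (a : g.Site) => if a ∈ SH i then (1 : ℝ) else 0) hb hNH hW hθ hδ₀ hα1
    htri hs.refl hs.dnn h261 hsmall hcntH hfix hR (hL.left β hβ0 hβ1)
  -- the transposed (3.88): G′ = G′₀ + VG′, V = Σ_□ h_□G′_□(∇*Pᵗ_□ + Cᵗ_□)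
  have hGT : 𝔬.Gp U = (∑ i, mulOp (𝔬.h i) * 𝔬.Gsq U i * mulOp (𝔬.h i)) +
      (∑ i, mulOp (𝔬.h i) * 𝔬.Gsq U i * (𝔬.Dstar U ∘ₗ 𝔬.Pt U i + 𝔬.Ct U i)) * 𝔬.Gp U :=
    fixedPoint_of_388T (mul_eq_one_comm.mp hi.inv) hi.eq388T
  have hsumD : (∑ i, mulOp (𝔬.h i) * 𝔬.Gsq U i * mulOp (𝔬.h i)) ∘ₗ 𝔬.Dstar U =
      ∑ i, (mulOp (𝔬.h i) * 𝔬.Gsq U i * mulOp (𝔬.h i)) ∘ₗ 𝔬.Dstar U := by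
    apply LinearMap.ext
    intro μ
    simp only [LinearMap.comp_apply, LinearMap.sum_apply]
  have hfixT : 𝔬.Gp U ∘ₗ 𝔬.Dstar U = (∑ i, (mulOp (𝔬.h i) * 𝔬.Gsq U i * mulOp (𝔬.h i)) ∘ₗ 𝔬.Dstar U) +
      (∑ i, mulOp (𝔬.h i) * 𝔬.Gsq U i * (𝔬.Dstar U ∘ₗ 𝔬.Pt U i + 𝔬.Ct U i)) ∘ₗ (𝔬.Gp U ∘ₗ 𝔬.Dstar U) := by
    conv_lhs => rw [hGT]
    rw [LinearMap.add_comp, Module.End.mul_eq_comp, LinearMap.comp_assoc, hsumD]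
  -- Φ^X∘V summed with N′
  have hsumV : 𝔭.ΦX U β ∘ₗ (∑ i, mulOp (𝔬.h i) * 𝔬.Gsq U i * (𝔬.Dstar U ∘ₗ 𝔬.Pt U i + 𝔬.Ct U i)) =
      ∑ i, 𝔭.ΦX U β ∘ₗ (mulOp (𝔬.h i) * 𝔬.Gsq U i * (𝔬.Dstar U ∘ₗ 𝔬.Pt U i + 𝔬.Ct U i)) := by
    apply LinearMap.ext
    intro μ
    rw [LinearMap.comp_apply, LinearMap.sum_apply, LinearMap.sum_apply, map_sum]
    rfl
  have hEV : HasMajorantHom (g := toB6 g R H) 𝔬.blk 𝔭.blkPX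
      (𝔭.ΦX U β ∘ₗ ∑ i, mulOp (𝔬.h i) * 𝔬.Gsq U i * (𝔬.Dstar U ∘ₗ 𝔬.Pt U i + 𝔬.Ct U i))
      (fun (y y' : g.Site) => N' * BV β * (g.len y ^ (1 - β) * (g.len y')⁻¹) * Real.exp (-(δ₀ * g.dist y y'))) := by
    rw [hsumV]
    refine hasMajorantHom_mono (g := toB6 g R H) 𝔬.blk 𝔭.blkPX
      (hasMajorantHom_fintypeSum 𝔬.blk 𝔭.blkPX
        (fun i => 𝔭.ΦX U β ∘ₗ (mulOp (𝔬.h i) * 𝔬.Gsq U i * (𝔬.Dstar U ∘ₗ 𝔬.Pt U i + 𝔬.Ct U i))) _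
        (hV.probeV β hβ0 hβ1)) fun y y' => ?_
    have h3 : 0 ≤ BV β * (g.len y ^ (1 - β) * (g.len y')⁻¹) * Real.exp (-(δ₀ * g.dist y y')) :=
      mul_nonneg (mul_nonneg hv (mul_nonneg (hW y) (inv_nonneg.mpr (hlen y')))) (Real.exp_nonneg _)
    calc (∑ i, (if y' ∈ 𝔬.S' i then (1 : ℝ) else 0) * BV β * (g.len y ^ (1 - β) * (g.len y')⁻¹) *
            Real.exp (-(δ₀ * g.dist y y')))
        = (∑ i, if y' ∈ 𝔬.S' i then (1 : ℝ) else 0) *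
            (BV β * (g.len y ^ (1 - β) * (g.len y')⁻¹) * Real.exp (-(δ₀ * g.dist y y'))) := by
          rw [Finset.sum_mul]
          exact Finset.sum_congr rfl fun i _ => by ring
      _ ≤ N' * (BV β * (g.len y ^ (1 - β) * (g.len y')⁻¹) * Real.exp (-(δ₀ * g.dist y y'))) :=
          mul_le_mul_of_nonneg_right (hs.cnt' y') h3
      _ = N' * BV β * (g.len y ^ (1 - β) * (g.len y')⁻¹) * Real.exp (-(δ₀ * g.dist y y')) := by ring
  have eR := rightMember_of_localLegs (R := R) (H := H) 𝔬.blk 𝔬.blkY 𝔭.blkPX d δ₀ α δ (N' * BV β) (Bl β) NH C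
    (fun y => g.len y ^ (1 - β)) (fun y => g.len y) (fun i (a : g.Site) => if a ∈ SH i then (1 : ℝ) else 0) hb hNH hC
    (mul_nonneg hN' hv) hW hs.lenpos hδ hδle hαδ₀ htri hs.dnn h261 hcntH hfixT h2 hEV (hL.right β hβ0 hβ1)
  -- the two constants against `holderConst`
  have hK : 0 ≤ holderConst d δ₀ α NH N' C (Bl β) (BV β) := by
    unfold holderConst
    positivity
  refine ⟨hasMajorantHom_mono (g := toB6 g R H) 𝔬.blk 𝔭.blkPY eL fun a b => ?_,
    hasMajorantHom_mono (g := toB6 g R H) 𝔬.blkY 𝔭.blkPX eR fun a b => ?_⟩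
  · have hinv : (1 - N' * (B₀ * Real.exp (δ₀ * ρ) * (κ.kP + κ.kC)) * B6.c1 d δ₀ α)⁻¹ ≤ 2 := by
      rw [inv_le_comm₀ (by linarith) (by norm_num : (0 : ℝ) < 2)]
      linarith
    have hA0 : 0 ≤ NH * Bl β * B6.c1 d δ₀ α := mul_nonneg (mul_nonneg hNH hb) hc1
    have h1 : NH * Bl β * B6.c1 d δ₀ α * (1 - N' * (B₀ * Real.exp (δ₀ * ρ) * (κ.kP + κ.kC)) * B6.c1 d δ₀ α)⁻¹ ≤
        holderConst d δ₀ α NH N' C (Bl β) (BV β) := by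
      calc NH * Bl β * B6.c1 d δ₀ α * (1 - N' * (B₀ * Real.exp (δ₀ * ρ) * (κ.kP + κ.kC)) * B6.c1 d δ₀ α)⁻¹
          ≤ NH * Bl β * B6.c1 d δ₀ α * 2 := mul_le_mul_of_nonneg_left hinv hA0
        _ = 2 * NH * Bl β * B6.c1 d δ₀ α := by ring
        _ ≤ holderConst d δ₀ α NH N' C (Bl β) (BV β) := by
            unfold holderConst
            have h0 : 0 ≤ NH * Bl β + N' * BV β * C * B6.c1 d δ₀ α :=
              add_nonneg (mul_nonneg hNH hb) (mul_nonneg (mul_nonneg (mul_nonneg hN' hv) hC) hc1)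
            linarith
    exact mul_le_mul (mul_le_mul_of_nonneg_right h1 (hW a)) (hexp a b) (Real.exp_nonneg _) (mul_nonneg hK (hW a))
  · have h1 : NH * Bl β + N' * BV β * C * B6.c1 d δ₀ α ≤ holderConst d δ₀ α NH N' C (Bl β) (BV β) := by
      unfold holderConst
      have h5 : 0 ≤ 2 * NH * Bl β * B6.c1 d δ₀ α := by positivity
      linarith
    exact mul_le_mul_of_nonneg_right (mul_le_mul_of_nonneg_right h1 (hW a)) (Real.exp_nonneg _)

omit [Fintype g.Site] [DecidableEq g.Site] in
/-- Arithmetic of «for M sufficiently large»: a size s ≦ θ₀M⁻¹ and M ≧ 2N′B₀e^{δ₀ρ}θ₀c₁ give N′B₀e^{δ₀ρ}sc₁ ≦ ½ (twin of the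
private lemma of `B9Thm37Whole`). [folklore] -/
private theorem small_of_size' {N' B₀ ex s θ₀ c M : ℝ} (hN' : 0 ≤ N') (hB : 0 ≤ B₀ * ex) (hc : 0 ≤ c) (hM : 0 < M)
    (hs : s ≤ θ₀ * M⁻¹) (hbig : 2 * N' * (B₀ * ex * θ₀) * c ≤ M) : N' * (B₀ * ex * s) * c ≤ 1 / 2 := by
  have h1 : N' * (B₀ * ex * s) * c ≤ N' * (B₀ * ex * (θ₀ * M⁻¹)) * c :=
    mul_le_mul_of_nonneg_right (mul_le_mul_of_nonneg_left (mul_le_mul_of_nonneg_left hs hB) hN') hc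
  have h2 : N' * (B₀ * ex * (θ₀ * M⁻¹)) * c = (N' * (B₀ * ex * θ₀) * c) / M := by
    rw [div_eq_mul_inv]
    ring
  have h3 : (N' * (B₀ * ex * θ₀) * c) / M ≤ 1 / 2 := by
    rw [div_le_iff₀ hM]
    linarith
  exact h1.trans (h2.le.trans h3)

omit [DecidableEq g.Site] in
/-- Downward monotonicity of a probe majorant of the printed shape (larger constant, slower rate; d ≧ 0, L^jη ≧ 0). [folklore] -/
private theorem probeMaj_mono' {W Z : Type} (blkW : W → g.Site) (blkZ : Z → g.Site) {T : (W → ℝ) →ₗ[ℝ] (Z → ℝ)}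
    {c c' δ δ' β : ℝ} (h : HasMajorantHom (g := toB6 g R H) blkW blkZ T
      (fun (a b : g.Site) => c * g.len a ^ (1 - β) * Real.exp (-(δ * g.dist a b))))
    (hcc' : c ≤ c') (hδ : δ' ≤ δ) (hdnn : ∀ a b : g.Site, 0 ≤ g.dist a b)
    (hlen : ∀ y : g.Site, 0 ≤ g.len y) (hc : 0 ≤ c) :
    HasMajorantHom (g := toB6 g R H) blkW blkZ T
      (fun (a b : g.Site) => c' * g.len a ^ (1 - β) * Real.exp (-(δ' * g.dist a b))) := by
  refine hasMajorantHom_mono (g := toB6 g R H) blkW blkZ h fun a b => ?_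
  have hW : 0 ≤ g.len a ^ (1 - β) := Real.rpow_nonneg (hlen a) _
  have hexp : Real.exp (-(δ * g.dist a b)) ≤ Real.exp (-(δ' * g.dist a b)) :=
    Real.exp_le_exp.mpr (neg_le_neg (mul_le_mul_of_nonneg_right hδ (hdnn a b)))
  exact mul_le_mul (mul_le_mul_of_nonneg_right hcc' hW) hexp (Real.exp_nonneg _)
    (mul_nonneg (hc.trans hcc') hW)

omit [Fintype g.Site] [DecidableEq g.Site] in
/-- The six (3.46) lines from the lines n = 0, 1, 2 and the lines n ≧ 3 (bookkeeping). [cite: Balaban1985BackgroundPropagators, (3.46) p.398] -/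
private theorem l2lines_of_split'' {K : B9.KernelFamily g B} {U : B.Cfg} {B₀ δ₀ : ℝ}
    (h012 : (∀ (lam : g.Loc) (h : g.Cut) (y y' : g.Site), g.cutIn h y → g.suppIn lam y' →
        K.l2 0 U lam h ≤ B₀ * B9.pref6 (g.len y) 0 * g.cutSup h * Real.exp (-(δ₀ * g.dist y y')) * g.l2Norm lam) ∧
      (∀ (lam : g.Loc) (h : g.Cut) (y y' : g.Site), g.cutIn h y → g.suppIn lam y' →
        K.l2 1 U lam h ≤ B₀ * B9.pref6 (g.len y) 1 * g.cutSup h * Real.exp (-(δ₀ * g.dist y y')) * g.l2Norm lam) ∧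
      (∀ (lam : g.Loc) (h : g.Cut) (y y' : g.Site), g.cutIn h y → g.suppIn lam y' →
        K.l2 2 U lam h ≤ B₀ * B9.pref6 (g.len y) 2 * g.cutSup h * Real.exp (-(δ₀ * g.dist y y')) * g.l2Norm lam))
    (h345 : ∀ (n : Fin 6), 3 ≤ n.val → ∀ (lam : g.Loc) (h : g.Cut) (y y' : g.Site), g.cutIn h y → g.suppIn lam y' →
        K.l2 n U lam h ≤ B₀ * B9.pref6 (g.len y) n * g.cutSup h * Real.exp (-(δ₀ * g.dist y y')) * g.l2Norm lam) :
    ∀ (n : Fin 6) (lam : g.Loc) (h : g.Cut) (y y' : g.Site), g.cutIn h y → g.suppIn lam y' →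
      K.l2 n U lam h ≤ B₀ * B9.pref6 (g.len y) n * g.cutSup h * Real.exp (-(δ₀ * g.dist y y')) * g.l2Norm lam := by
  obtain ⟨h0, h1, h2⟩ := h012
  intro n
  fin_cases n
  · exact h0
  · exact h1
  · exact h2
  · exact h345 3 (by decide)
  · exact h345 4 (by decide)
  · exact h345 5 (by decide)

end GpSide

/-! ## §2 The leaf of Theorem 3.7 at the all-blocks pin with (3.43) proved inside -/

section AllPins

variable {I : Type} {c35 : ℝ} {geo : I → B9.Geometry} {bg : I → B9.Backgrounds}
variable [∀ i, Fintype (geo i).Site] [∀ i, DecidableEq (geo i).Site]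

/-- ★ **THEOREM 3.7 AT THE ALL-BLOCKS PIN WITH (3.42) + (3.47) + (3.46)₁,₂,₃ + (3.43) PROVED INSIDE** — the sibling
`B9RWSums346Schur.thm37Printed_allPin_schur` with the displayed residual shrunk further: only the input-side Hölder lines
(3.44), (3.45) and the L² lines (3.46)₄,₅,₆ of `K i` remain displayed (`hrest`).  Inputs beyond the sibling's: the probe letters
`𝔭 i` and the co-readings `H1Reads` of `(K i).h1` by (∇_UG′(U), G′(U)∇\*_U); per member and per U under Corollary 3.6's provisos
(M ≧ M₁, 0 < α₀, O(1)Mα₀ ≦ a₁, (3.35)) Corollary 3.6 for the G′_□ and the structure of (3.88) (`Local342`, `Identities` — the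
SAME packages n06-c's `thm37Printed_of_local342` consumes, at Cor. 3.6's rate δ₁), the Hölder legs (`HolderLegs37`) and the
V-term probe bounds (`HolderV37`); the static data and sizes (`StaticOK`, `Sizes.Bounded`: the K(h_□) sizes ≦ θ₀M⁻¹), the
overlap count N_H, [4] (2.61) at (δ₁, α₁) for M ≧ M_L; the Conv342 rate δ with 0 ≦ δ ≦ (1 − α₁)δ₁; B₀(β) ≧ `holderConst …`(β).
«M sufficiently large»: M′ := max(M_g, M_r, M₁, M_L, 2N′B₁e^{δ₁ρ}θ₀c₁(α₁)); a′ := min(a_r, a₁∕O(1)).  Nothing of print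
asserted; NOT a node discharge. [cite: Balaban1985BackgroundPropagators, Thm 3.7 (3.87)–(3.90) pp.408–410 + (3.42)–(3.47) pp.397–398 + Cor. 3.6 p.408; Balaban1984PropagatorsII, Lemma 2.1 (2.61) p.234] -/
theorem thm37Printed_allPin_schur_holder {X Y ι PX PY : I → Type} [∀ i, Fintype (X i)] [∀ i, DecidableEq (X i)]
    [∀ i, Fintype (Y i)] [∀ i, DecidableEq (Y i)] [∀ i, Fintype (ι i)] [∀ i, Fintype (PX i)] [∀ i, DecidableEq (PX i)]
    [∀ i, Fintype (PY i)] [∀ i, DecidableEq (PY i)]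
    {𝔴 : ∀ i, B9.RWExpansion (geo i) (bg i)} {𝔬 : ∀ i, Ops (geo i) (bg i) (X i) (Y i) (ι i)}
    {R : I → ℝ} {H : I → Prop} {C δ : ℝ}
    (𝔭 : ∀ i, HolderProbes (geo i) (bg i) (X i) (Y i) (PX i) (PY i))
    (K : ∀ i, B9.KernelFamily (geo i) (bg i)) (ev : ∀ i, (geo i).Loc → X i → ℝ) (evY : ∀ i, (geo i).Loc → Y i → ℝ)
    {d : ℕ} {α L₀ B₀ δ₀ Mg Mr ar : ℝ} {Bβ Bε : ℝ → ℝ} {Bεβ : ℝ → ℝ → ℝ}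
    (κ : I → Sizes) (SH : ∀ i, ι i → Finset (geo i).Site) (Bl BV : ℝ → ℝ) (d₁ : ℕ)
    (δ₁ α₁ ρ N N' Cℓ Kc θ₀ B₁ NH a₁ M₁ ML : ℝ)
    (h37 : B9.Thm37Printed c35 geo bg (fun i => E37OfOps (𝔴 i) (𝔬 i) (R i) (H i) C δ))
    (hco0 : ∀ i U, CoRealizes (K i) 0 U (𝔬 i).blk (𝔬 i).blk (ev i) ((𝔬 i).Gp U))
    (hco1 : ∀ i U, CoRealizes (K i) 1 U (𝔬 i).blkY (𝔬 i).blk (ev i) ((𝔬 i).D U ∘ₗ (𝔬 i).Gp U))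
    (hco2 : ∀ i U, CoRealizes (K i) 2 U (𝔬 i).blk (𝔬 i).blkY (evY i) ((𝔬 i).Gp U ∘ₗ (𝔬 i).Dstar U))
    (hco3 : ∀ i U, CoRealizes (K i) 3 U (𝔬 i).blk (𝔬 i).blk (ev i) ((𝔬 i).Lap U ∘ₗ (𝔬 i).Gp U))
    (hgl0 : ∀ i U, GlobReads (K i) 0 U (𝔬 i).blk (𝔬 i).blk (ev i) ((𝔬 i).Gp U))
    (hgl1 : ∀ i U, GlobReads (K i) 1 U (𝔬 i).blkY (𝔬 i).blk (ev i) ((𝔬 i).D U ∘ₗ (𝔬 i).Gp U))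
    (hgl2 : ∀ i U, GlobReads (K i) 2 U (𝔬 i).blk (𝔬 i).blkY (evY i) ((𝔬 i).Gp U ∘ₗ (𝔬 i).Dstar U))
    (hgl3 : ∀ i U, GlobReads (K i) 3 U (𝔬 i).blk (𝔬 i).blk (ev i) ((𝔬 i).Lap U ∘ₗ (𝔬 i).Gp U))
    (hl0 : ∀ i U, L2Reads (R := R i) (H := H i) (K i) 0 U (𝔬 i).blk (𝔬 i).blk (ev i) ((𝔬 i).Gp U))
    (hl1 : ∀ i U, L2Reads (R := R i) (H := H i) (K i) 1 U (𝔬 i).blkY (𝔬 i).blk (ev i) ((𝔬 i).D U ∘ₗ (𝔬 i).Gp U))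
    (hl2 : ∀ i U, L2Reads (R := R i) (H := H i) (K i) 2 U (𝔬 i).blk (𝔬 i).blkY (evY i) ((𝔬 i).Gp U ∘ₗ (𝔬 i).Dstar U))
    (hH1 : ∀ i U, H1Reads (K i) U (𝔭 i) (𝔬 i).blk (𝔬 i).blkY (ev i) (evY i) ((𝔬 i).D U ∘ₗ (𝔬 i).Gp U)
      ((𝔬 i).Gp U ∘ₗ (𝔬 i).Dstar U))
    (hsym : ∀ i U, IsTransposePair ((𝔬 i).Gp U) ((𝔬 i).Gp U))
    (htr : ∀ i U, IsTransposePair ((𝔬 i).D U ∘ₗ (𝔬 i).Gp U) ((𝔬 i).Gp U ∘ₗ (𝔬 i).Dstar U))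
    (hfacts : ∀ i, Mg ≤ (geo i).M → Facts347 (geo i) (R i) (H i) d δ α L₀)
    (hdsymm : ∀ i (a b : (geo i).Site), (geo i).dist a b = (geo i).dist b a)
    (hC : 0 ≤ C) (hCB : C ≤ B₀) (hCL : C * L₀ ≤ B₀) (hδ₀ : δ₀ ≤ (1 - α) * δ) (hα : 0 ≤ α * δ)
    (hCg : C * B6.c1 d δ (1 - α) * L₀ ^ (4 : ℝ) ≤ B₀) (har : 0 < ar)
    -- the Hölder inputs
    (hc : 0 < c35) (ha₁ : 0 < a₁) (hα₁ : 0 ≤ α₁) (hα₁1 : α₁ ≤ 1) (hN' : 0 ≤ N') (hB₁ : 0 ≤ B₁) (hNH : 0 ≤ NH)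
    (hM₁ : 0 < M₁) (hδnn : 0 ≤ δ) (hδδ₁ : δ ≤ (1 - α₁) * δ₁) (hδ₁ : 0 ≤ δ₁)
    (hst : ∀ i, StaticOK (𝔬 i) ρ N N' Cℓ (κ i)) (hκ : ∀ i, (κ i).Bounded Kc θ₀ Cℓ (geo i).M)
    (hcntH : ∀ i (a : (geo i).Site), (∑ q, if a ∈ SH i q then (1 : ℝ) else 0) ≤ NH)
    (hBl : ∀ β, 0 ≤ β → β < 1 → 0 ≤ Bl β) (hBV : ∀ β, 0 ≤ β → β < 1 → 0 ≤ BV β)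
    (hBβ : ∀ β, 0 ≤ β → β < 1 → holderConst d₁ δ₁ α₁ NH N' C (Bl β) (BV β) ≤ Bβ β)
    (h261 : ∀ i, ML ≤ (geo i).M → Ineq261 d₁ (toB6 (geo i) (R i) (H i)) δ₁ α₁)
    (hop : ∀ i, M₁ ≤ (geo i).M → ∀ α₀ : ℝ, 0 < α₀ → c35 * (geo i).M * α₀ ≤ a₁ →
      ∀ U : (bg i).Cfg, (bg i).Reg335 c35 α₀ U →
        Local342 (𝔬 i) (R i) (H i) B₁ δ₁ U ∧ Identities (𝔬 i) (R i) (H i) U ∧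
          HolderLegs37 (𝔬 i) (𝔭 i) (R i) (H i) (SH i) Bl δ₁ U ∧ HolderV37 (𝔬 i) (𝔭 i) (R i) (H i) BV δ₁ U)
    -- the displayed residual: (3.44), (3.45), (3.46)₄₅₆
    (hrest : ∀ i, Mr ≤ (geo i).M → ∀ α₀ : ℝ, 0 < α₀ → (geo i).M * α₀ ≤ ar → ∀ U : (bg i).Cfg, (bg i).Reg335 c35 α₀ U →
      (∀ (ε : ℝ) (lam : (geo i).Loc) (y y' : (geo i).Site), 0 < ε → ε ≤ 1 → (geo i).suppInT lam y' →
          (K i).e4 U lam y ≤ Bε ε * Real.exp (-(δ₀ * (geo i).dist y y')) * ((geo i).holder ε lam + (geo i).supNorm lam)) ∧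
        (∀ (ε β : ℝ) (lam : (geo i).Loc) (ζ : (geo i).Cut) (y y' : (geo i).Site), 0 < ε → ε ≤ 1 → 0 ≤ β → β < 1 →
          (geo i).cutInT ζ y → (geo i).suppInT lam y' →
          (K i).h2 U lam β ζ ≤ Bεβ ε β * ((geo i).len y) ^ (-β) * (geo i).cutH β ζ *
            Real.exp (-(δ₀ * (geo i).dist y y')) * ((geo i).holder (β + ε) lam + (geo i).supNorm lam)) ∧
        ∀ (n : Fin 6), 3 ≤ n.val → ∀ (lam : (geo i).Loc) (h : (geo i).Cut) (y y' : (geo i).Site), (geo i).cutIn h y →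
          (geo i).suppIn lam y' →
          (K i).l2 n U lam h ≤ B₀ * B9.pref6 ((geo i).len y) n * (geo i).cutSup h * Real.exp (-(δ₀ * (geo i).dist y y')) *
            (geo i).l2Norm lam) :
    B9.Thm37Printed c35 geo bg (fun i => E37AllOfOps (𝔴 i) (𝔬 i) (R i) (H i) C δ (K i) B₀ δ₀ Bβ Bε Bεβ) := by
  have hδ₀' : δ₀ ≤ δ := hδ₀.trans (by nlinarith [hα])
  set Mbig : ℝ := 2 * N' * (B₁ * Real.exp (δ₁ * ρ) * θ₀) * B6.c1 d₁ δ₁ α₁ with hMbig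
  refine thm37Printed_strengthen h37 (max (max Mg Mr) (max (max M₁ ML) Mbig)) (min ar (a₁ / c35))
    (lt_min har (div_pos ha₁ hc)) fun i hM α₀ hα₀ hMa U hU hconv => ?_
  have hMg : Mg ≤ (geo i).M := le_trans (le_trans (le_max_left _ _) (le_max_left _ _)) hM
  have hMr : Mr ≤ (geo i).M := le_trans (le_trans (le_max_right _ _) (le_max_left _ _)) hM
  have hM₁i : M₁ ≤ (geo i).M := le_trans (le_trans (le_trans (le_max_left _ _) (le_max_left _ _)) (le_max_right _ _)) hM
  have hMLi : ML ≤ (geo i).M := le_trans (le_trans (le_trans (le_max_right _ _) (le_max_left _ _)) (le_max_right _ _)) hM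
  have hMb : Mbig ≤ (geo i).M := le_trans (le_trans (le_max_right _ _) (le_max_right _ _)) hM
  have hMpos : 0 < (geo i).M := lt_of_lt_of_le hM₁ hM₁i
  have ha : c35 * (geo i).M * α₀ ≤ a₁ := by
    have h1 : (geo i).M * α₀ * c35 ≤ a₁ := (le_div_iff₀ hc).mp (hMa.trans (min_le_right _ _))
    calc c35 * (geo i).M * α₀ = (geo i).M * α₀ * c35 := by ring
      _ ≤ a₁ := h1
  have hlen : ∀ y : (geo i).Site, 0 ≤ (geo i).len y := fun y => ((hst i).lenpos y).le
  obtain ⟨hl, hi, hL, hV⟩ := hop i hM₁i α₀ hα₀ ha U hU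
  obtain ⟨h344, h345, h346⟩ := hrest i hMr α₀ hα₀ (hMa.trans (min_le_left _ _)) U hU
  obtain ⟨h0, h1, h2, h3⟩ := hconv
  have hBe : 0 ≤ B₁ * Real.exp (δ₁ * ρ) := mul_nonneg hB₁ (Real.exp_nonneg _)
  have hq : N' * (B₁ * Real.exp (δ₁ * ρ) * ((κ i).kP + (κ i).kC)) * B6.c1 d₁ δ₁ α₁ ≤ 1 / 2 :=
    small_of_size' hN' hBe (c1_nonneg d₁ δ₁ α₁) hMpos (hκ i).row (by rw [hMbig] at hMb; exact hMb)
  -- the member (3.43): both probe majorants at (holderConst, δ), then at (Bβ, δ₀)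
  have hH := holder343_of_local37 (𝔬 i) (𝔭 i) (R i) (H i) d₁ δ₁ α₁ ρ B₁ N N' Cℓ NH C δ (κ i) (SH i) Bl BV U hB₁ hδ₁ hα₁
    hα₁1 hN' hNH hC hδnn hδδ₁ (hst i) (hκ i).nonneg (hcntH i) hBl hBV (h261 i hMLi) hq hl hi hL hV h2
  have hK0 : ∀ β, 0 ≤ β → β < 1 → 0 ≤ holderConst d₁ δ₁ α₁ NH N' C (Bl β) (BV β) := by
    intro β hβ0 hβ1
    have hb := hBl β hβ0 hβ1
    have hv := hBV β hβ0 hβ1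
    have hc1 : 0 ≤ B6.c1 d₁ δ₁ α₁ := c1_nonneg d₁ δ₁ α₁
    unfold holderConst
    positivity
  have hLβ : ∀ β, 0 ≤ β → β < 1 → HasMajorantHom (g := toB6 (geo i) (R i) (H i)) (𝔬 i).blk (𝔭 i).blkPY
      ((𝔭 i).ΦY U β ∘ₗ ((𝔬 i).D U ∘ₗ (𝔬 i).Gp U))
      (fun (a b : (geo i).Site) => Bβ β * (geo i).len a ^ (1 - β) * Real.exp (-(δ₀ * (geo i).dist a b))) := by
    intro β hβ0 hβ1
    have h := (hH β hβ0 hβ1).1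
    rw [LinearMap.comp_assoc] at h
    exact probeMaj_mono' (𝔬 i).blk (𝔭 i).blkPY h (hBβ β hβ0 hβ1) hδ₀' (hst i).dnn hlen (hK0 β hβ0 hβ1)
  have hRβ : ∀ β, 0 ≤ β → β < 1 → HasMajorantHom (g := toB6 (geo i) (R i) (H i)) (𝔬 i).blkY (𝔭 i).blkPX
      ((𝔭 i).ΦX U β ∘ₗ ((𝔬 i).Gp U ∘ₗ (𝔬 i).Dstar U))
      (fun (a b : (geo i).Site) => Bβ β * (geo i).len a ^ (1 - β) * Real.exp (-(δ₀ * (geo i).dist a b))) :=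
    fun β hβ0 hβ1 => probeMaj_mono' (𝔬 i).blkY (𝔭 i).blkPX (hH β hβ0 hβ1).2 (hBβ β hβ0 hβ1) hδ₀' (hst i).dnn hlen
      (hK0 β hβ0 hβ1)
  have hBβ0 : ∀ β, 0 ≤ β → β < 1 → 0 ≤ Bβ β := fun β hβ0 hβ1 => (hK0 β hβ0 hβ1).trans (hBβ β hβ0 hβ1)
  have h343 := line343_of_hasMajorantHom (R := R i) (H := H i) (hH1 i U) hBβ0 hlen hLβ hRβ
  have h012 := l2lines012_of_majorants (𝔬 i).blk (𝔬 i).blkY (ev i) (evY i) h0 h1 h2 (hsym i U) (htr i U) (hl0 i U) (hl1 i U)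
    (hl2 i U) (hfacts i hMg) (hdsymm i) ((hst i).dnn) ((hst i).lenpos) hC hCL hδ₀
  exact ⟨⟨h0, h1, h2, h3⟩, allIneqs_of_majorants (𝔬 i).blk (𝔬 i).blkY (ev i) (evY i) h0 h1 h2 h3 (hco0 i U) (hco1 i U)
    (hco2 i U) (hco3 i U) (hgl0 i U) (hgl1 i U) (hgl2 i U) (hgl3 i U) (hfacts i hMg) ((hst i).dnn) ((hst i).lenpos) hC hCB
    hδ₀' hCg (ineq343_345_of_lines h343 h344 h345) (l2lines_of_split'' h012 h346)⟩

end AllPins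

end

end Literature.MathematicalPhysics.QuantumFieldTheory.Balaban1983to89.B9RWSums343HolderGp
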